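import Literature.NumberTheory.Automorphic.CompactGroupCharacters   -- ★ additive half: `orthonormal_addCharLp`, `summable_norm_sq_integral_conj_addChar_mul` (Bessel)
import Mathlib.MeasureTheory.Measure.Haar.Basic
import Mathlib.MeasureTheory.Group.Integral
import Mathlib.MeasureTheory.Function.L2Space
import Mathlib.Analysis.InnerProductSpace.Orthonormal
import Mathlib.Analysis.Complex.Circle
import Mathlib.Analysis.Real.Sqrt
import HarnessLib

/-!
# K2·E1 — RUNG 2 of the payer programme of `sig_K2E1ResidualCompactU2`: RIEMANN–LEBESGUE on a compact group
# (Fourier coefficients against distinct characters tend to `0`), from BESSEL's inequality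

Cell `hodgecm-mathlib`, Track B ∕ K2-LIT, squad K2, ENGINE E1 (line `K2_E1_TraceFormulaBeta`, socket module
`K2_E1_TraceFormulaBetaSigs_GlobalIndex`, live socket `sig_K2E1ResidualCompactU2` :243 = ★ `CmResidualSpectrumCompact L 2 μ`);
crux H413 = `stmt-HodgeConjecture-24833` (route `HCCMUnconditional`); seat K2E1-p09 (g2), DEAL K2E1-plan (g0) 2026-09-03T23:15:00Z.
Lane `--supports stmt-HodgeConjecture-24833 --as helper`: abstract harmonic analysis (Mathlib + the tree's ★
`Literature/NumberTheory/Automorphic/CompactGroupCharacters`), no definition, no instance, no named fact, no `sorry`.  Closes no socket.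
HONEST LABEL: HC_CM is proved only modulo the 7 printed citations (2 remaining named inputs: hLiu418 = `stmt-HodgeConjecture-24832`,
h413 = `stmt-HodgeConjecture-24833`) until rung 0 closes; nothing here changes that count.

WHAT RUNG 1 (★ `K2E1DiagonalCharacterOperatorCompact`, p855556) CONSUMES: the eigenvalues `c_χ = f̂(χ) = ∫ f(g) χ(det g) dη(g)` of `R(f)` on the
lines `ℂ·(χ∘det) ⊆ L²_res(U(Φ₂))` TEND TO `0` along the cofinite filter of the characters `χ` [MoeglinWaldspurger1995, I.2.18; Rogawski1990,
§13.5].  ROAD (survey memo 2026-09-03T23:3xZ): NOT Stone–Weierstrass ∕ separation of points, but BESSEL — distinct continuous unitary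
characters of a group with an invariant probability measure are ORTHONORMAL in `L²`, so for `f ∈ L²` the Fourier coefficients are square
summable, hence tend to `0` cofinitely (`Summable.tendsto_cofinite_zero`).  No «characters separate points» binder is needed for DECAY.

* §1 PURE HILBERT-SPACE FORM (what the unfolding road `c_χ = vol⁻¹·⟪χ̄∘det, Pf⟫_{L²([U(2)])}` consumes directly): for an orthonormal family `e`
  and any vector `x`, `⟪e i, x⟫ → 0` cofinitely (`tendsto_inner_cofinite_of_orthonormal`, Mathlib `Orthonormal.inner_products_summable`); the same
  for a pairwise ORTHOGONAL family of non-zero vectors of BOUNDED norm (`tendsto_inner_cofinite_of_orthogonal`), and stability under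
  re-indexing by an injection (`χ ↦ χ̄`).
* §2 MULTIPLICATIVE CHARACTERS `χ : G →* Circle` (the twin of the ★ additive file, for `[U(1)] = U(1)(L⁺)∖U(1)(𝔸_{L⁺})` is written
  multiplicatively; `G` any group with a left-invariant probability measure): vanishing `∫ χ = 0` for `χ ≠ 1`, orthogonality
  `∫ conj χ · χ' = δ`, orthonormality in `L²`, Bessel, and **RIEMANN–LEBESGUE** `tendsto_integral_conj_monoidHom_mul_cofinite`:
  `∫ conj(χ_i) f dμ → 0` cofinitely for `f ∈ L²(μ)` and an injective family of continuous `χ_i`; un-conjugated form; continuous `f` on compact `G`.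
* §3 the ADDITIVE corollary over ★ `summable_norm_sq_integral_conj_addChar_mul` (`AddChar C Circle`, e.g. `𝔸_K ⧸ K`).

References: [folklore] (A. Weil, *L'intégration dans les groupes topologiques* (1940) §§27–28; Deitmar–Echterhoff, *Principles of Harmonic
Analysis*, Ch. 3 and Lemma 3.3.7 Riemann–Lebesgue); [MoeglinWaldspurger1995] I.2.18; [Rogawski1990] §13.5 pp. 204–206.
-/

set_option autoImplicit false
-- the mandated namespace has the single-problem summit's repeated segment (`HodgeConjecture.HodgeConjecture`)
set_option linter.dupNamespace false

noncomputable section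

namespace Summit.HodgeConjecture.HodgeConjecture.Cruxes.H413.K2E1CompactAbelianRiemannLebesgue

open Filter Topology MeasureTheory Complex
open scoped InnerProductSpace ComplexConjugate

/-! ## §0 From square-summability to decay -/

/-- A family of scalars with SQUARE-SUMMABLE norms tends to `0` along the cofinite filter. [folklore] -/
theorem tendsto_cofinite_zero_of_summable_norm_sq {ι : Type*} {𝕜 : Type*} [NormedAddCommGroup 𝕜] {c : ι → 𝕜}
    (h : Summable fun i => ‖c i‖ ^ 2) : Tendsto c cofinite (𝓝 0) := by
  rw [tendsto_zero_iff_norm_tendsto_zero]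
  have h2 : Tendsto (fun i => ‖c i‖ ^ 2) cofinite (𝓝 0) := h.tendsto_cofinite_zero
  have h3 : Tendsto (fun i => Real.sqrt (‖c i‖ ^ 2)) cofinite (𝓝 (Real.sqrt 0)) := h2.sqrt
  rw [Real.sqrt_zero] at h3
  refine h3.congr fun i => ?_
  rw [Real.sqrt_sq (norm_nonneg _)]

/-! ## §1 Pure Hilbert-space form: Fourier coefficients against an orthonormal family tend to zero -/

section Hilbert

variable {𝕜 : Type*} [RCLike 𝕜] {E : Type*} [NormedAddCommGroup E] [InnerProductSpace 𝕜 E] {ι : Type*}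

/-- **Bessel ⇒ decay.**  For an orthonormal family `e` of an inner-product space and any vector `x`, the Fourier coefficients `⟪e i, x⟫` tend to `0`
along the cofinite filter (they are square summable: Mathlib `Orthonormal.inner_products_summable`). [folklore] -/
theorem tendsto_inner_cofinite_of_orthonormal {e : ι → E} (he : Orthonormal 𝕜 e) (x : E) :
    Tendsto (fun i => ⟪e i, x⟫_𝕜) cofinite (𝓝 0) :=
  tendsto_cofinite_zero_of_summable_norm_sq (he.inner_products_summable x)

/-- The conjugate-linear slot: `⟪x, e i⟫ → 0` cofinitely as well. [folklore] -/
theorem tendsto_inner_cofinite_of_orthonormal' {e : ι → E} (he : Orthonormal 𝕜 e) (x : E) :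
    Tendsto (fun i => ⟪x, e i⟫_𝕜) cofinite (𝓝 0) := by
  have h := tendsto_inner_cofinite_of_orthonormal he x
  rw [tendsto_zero_iff_norm_tendsto_zero] at h ⊢
  refine h.congr fun i => ?_
  rw [norm_inner_symm]

/-- **Orthogonal family of bounded non-zero vectors** (the eigenvectors `χ∘det`, all of norm `√vol`): if the `v i` are pairwise orthogonal, non-zero and
`‖v i‖ ≤ R`, then `⟪v i, x⟫ → 0` cofinitely for every `x` (normalise and use `tendsto_inner_cofinite_of_orthonormal`; `|⟪v i, x⟫| ≤ R |⟪e i, x⟫|`).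
The bound `R` is needed: `v i = i • e i` against `x = Σ i⁻¹ e i` has `⟪v i, x⟫ = 1`. [folklore] -/
theorem tendsto_inner_cofinite_of_orthogonal {v : ι → E} (hv0 : ∀ i, v i ≠ 0) (hvo : Pairwise fun i j => ⟪v i, v j⟫_𝕜 = 0)
    {R : ℝ} (hR : ∀ i, ‖v i‖ ≤ R) (x : E) : Tendsto (fun i => ⟪v i, x⟫_𝕜) cofinite (𝓝 0) := by
  classical
  -- the normalised family is orthonormal
  have he : Orthonormal 𝕜 (fun i => ((‖v i‖⁻¹ : ℝ) : 𝕜) • v i) := by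
    rw [orthonormal_iff_ite]
    intro i j
    rw [inner_smul_left, inner_smul_right, RCLike.conj_ofReal]
    split_ifs with h
    · subst h
      rw [inner_self_eq_norm_sq_to_K]
      have hn : (‖v i‖ : 𝕜) ≠ 0 := by exact_mod_cast norm_ne_zero_iff.2 (hv0 i)
      push_cast
      field_simp
    · rw [hvo h, mul_zero, mul_zero]
  have h := tendsto_inner_cofinite_of_orthonormal he x
  rw [tendsto_zero_iff_norm_tendsto_zero] at h ⊢
  have h' : Tendsto (fun i => R * ‖⟪((‖v i‖⁻¹ : ℝ) : 𝕜) • v i, x⟫_𝕜‖) cofinite (𝓝 0) := by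
    have h2 := h.const_mul R
    rwa [mul_zero] at h2
  · -- `‖⟪v i, x⟫‖ = ‖v i‖ · ‖⟪e i, x⟫‖ ≤ R · ‖⟪e i, x⟫‖`
    refine squeeze_zero (fun i => norm_nonneg _) (fun i => ?_) h'
    have hvi : ⟪v i, x⟫_𝕜 = (‖v i‖ : 𝕜) * ⟪((‖v i‖⁻¹ : ℝ) : 𝕜) • v i, x⟫_𝕜 := by
      rw [inner_smul_left, RCLike.conj_ofReal, ← mul_assoc]
      have hn : (‖v i‖ : 𝕜) ≠ 0 := by exact_mod_cast norm_ne_zero_iff.2 (hv0 i)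
      push_cast
      rw [mul_inv_cancel₀ hn, one_mul]
    rw [hvi, norm_mul, RCLike.norm_ofReal, abs_norm]
    exact mul_le_mul_of_nonneg_right (hR i) (norm_nonneg _)

/-- Re-indexing along an INJECTION preserves cofinite decay (e.g. `χ ↦ χ̄ = χ⁻¹` on characters: the eigenvalue of `R(f)` on `ℂ·(χ∘det)` is the
coefficient of the periodisation against `χ̄∘det`). [folklore] -/
theorem tendsto_comp_cofinite_of_injective {α β M : Type*} [TopologicalSpace M] {c : β → M} {m : M} (hc : Tendsto c cofinite (𝓝 m))
    {σ : α → β} (hσ : Function.Injective σ) : Tendsto (c ∘ σ) cofinite (𝓝 m) :=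
  hc.comp hσ.tendsto_cofinite

end Hilbert

/-! ## §2 Multiplicative unitary characters of a group with an invariant probability measure -/

section Characters

variable {G : Type*} [Group G] [MeasurableSpace G] (μ : Measure G)

section Vanishing

variable [MeasurableMul G] [μ.IsMulLeftInvariant]

/-- **A non-trivial character has integral zero** against a left-invariant measure: `∫ χ = χ(a) ∫ χ` by the substitution `x ↦ a x`
(multiplicative twin of ★ `integral_addChar_eq_zero`). [folklore] -/
theorem integral_monoidHom_eq_zero (χ : G →* Circle) {a : G} (ha : χ a ≠ 1) :
    ∫ x, (χ x : ℂ) ∂μ = 0 := by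
  have h := integral_mul_left_eq_self (μ := μ) (fun x => (χ x : ℂ)) a
  simp only [map_mul, Circle.coe_mul] at h
  rw [integral_const_mul] at h
  have hne : (χ a : ℂ) - 1 ≠ 0 := by
    rwa [sub_ne_zero, ne_eq, Circle.coe_eq_one]
  have : ((χ a : ℂ) - 1) * ∫ x, (χ x : ℂ) ∂μ = 0 := by rw [sub_mul, one_mul, h, sub_self]
  exact (mul_eq_zero.1 this).resolve_left hne

/-- **Orthogonality of characters**: `∫ conj(χ) χ' dμ = δ_{χ, χ'}` for an invariant probability measure (`conj χ · χ' = χ' / χ` is a character,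
non-trivial iff `χ ≠ χ'`; multiplicative twin of ★ `integral_conj_addChar_mul_addChar`). [folklore] -/
theorem integral_conj_monoidHom_mul_monoidHom [IsProbabilityMeasure μ] [DecidableEq (G →* Circle)] (χ χ' : G →* Circle) :
    ∫ x, conj (χ x : ℂ) * (χ' x : ℂ) ∂μ = if χ = χ' then 1 else 0 := by
  have hconj : ∀ x, conj (χ x : ℂ) * (χ' x : ℂ) = ((χ' / χ) x : ℂ) := by
    intro x
    rw [MonoidHom.div_apply, Circle.coe_div, ← Circle.coe_inv_eq_conj, Circle.coe_inv, mul_comm, div_eq_mul_inv]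
  simp_rw [hconj]
  split_ifs with h
  · subst h
    simp
  · have hne : χ' / χ ≠ 1 := by
      intro h1
      apply h
      have : χ' = χ := by rwa [div_eq_one] at h1
      exact this.symm
    obtain ⟨a, ha⟩ : ∃ a, (χ' / χ) a ≠ 1 := by
      by_contra hall
      simp only [not_exists, not_not] at hall
      exact hne (MonoidHom.ext hall)
    exact integral_monoidHom_eq_zero μ (χ' / χ) ha

end Vanishing

section L2

variable [TopologicalSpace G] [OpensMeasurableSpace G] [IsProbabilityMeasure μ]

/-- A continuous unitary character is in `L²` of a probability measure (bounded by `1`). [folklore] -/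
theorem memLp_monoidHom {χ : G →* Circle} (hχ : Continuous fun x => (χ x : ℂ)) :
    MemLp (fun x => (χ x : ℂ)) 2 μ :=
  MemLp.of_bound hχ.aestronglyMeasurable 1 (Filter.Eventually.of_forall fun x => by simp)

/-- The inner product in `L²(μ)` of the class of a continuous character with the class of `f ∈ L²`: `⟪χ, f⟫ = ∫ conj(χ) f dμ`. [folklore] -/
theorem inner_toLp_monoidHom_toLp {χ : G →* Circle} (hχ : Continuous fun x => (χ x : ℂ)) {f : G → ℂ} (hf : MemLp f 2 μ) :
    inner ℂ ((memLp_monoidHom μ hχ).toLp _) (hf.toLp f) = ∫ x, conj (χ x : ℂ) * f x ∂μ := by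
  rw [MeasureTheory.L2.inner_def]
  refine integral_congr_ae ?_
  filter_upwards [(memLp_monoidHom μ hχ).coeFn_toLp, hf.coeFn_toLp] with a ha hb
  rw [ha, hb, RCLike.inner_apply']

variable [MeasurableMul G] [μ.IsMulLeftInvariant]

/-- **Distinct continuous characters are ORTHONORMAL in `L²(G, μ)`** for a left-invariant probability measure `μ` (their `L²`-classes
`MemLp.toLp`; multiplicative twin of ★ `orthonormal_addCharLp`). [folklore] -/
theorem orthonormal_toLp_monoidHom {ι : Type*} {χ : ι → G →* Circle} (hinj : Function.Injective χ)
    (hχ : ∀ i, Continuous fun x => (χ i x : ℂ)) :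
    Orthonormal ℂ fun i => (memLp_monoidHom μ (hχ i)).toLp _ := by
  classical
  rw [orthonormal_iff_ite]
  intro i j
  rw [inner_toLp_monoidHom_toLp μ (hχ i) (memLp_monoidHom μ (hχ j)), integral_conj_monoidHom_mul_monoidHom μ]
  simp only [hinj.eq_iff]

/-- **Bessel's inequality for characters, summable form**: for `f ∈ L²(G, μ)` and an injective family of continuous characters `χ_i`, the Fourier
coefficients `∫ conj(χ_i) f dμ` are SQUARE SUMMABLE (Mathlib `Orthonormal.inner_products_summable`). [folklore] -/
theorem summable_norm_sq_integral_conj_monoidHom_mul {ι : Type*} {χ : ι → G →* Circle} (hinj : Function.Injective χ)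
    (hχ : ∀ i, Continuous fun x => (χ i x : ℂ)) {f : G → ℂ} (hf : MemLp f 2 μ) :
    Summable fun i => ‖∫ x, conj (χ i x : ℂ) * f x ∂μ‖ ^ 2 := by
  have h := (orthonormal_toLp_monoidHom μ hinj hχ).inner_products_summable (hf.toLp f)
  refine h.congr fun i => ?_
  rw [inner_toLp_monoidHom_toLp μ (hχ i) hf]

/-- **Bessel's inequality for characters**: `Σ_i |∫ conj(χ_i) f dμ|² ≤ ∫ |f|² dμ`. [folklore] -/
theorem tsum_norm_sq_integral_conj_monoidHom_mul_le {ι : Type*} {χ : ι → G →* Circle} (hinj : Function.Injective χ)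
    (hχ : ∀ i, Continuous fun x => (χ i x : ℂ)) {f : G → ℂ} (hf : MemLp f 2 μ) :
    ∑' i, ‖∫ x, conj (χ i x : ℂ) * f x ∂μ‖ ^ 2 ≤ ∫ x, ‖f x‖ ^ 2 ∂μ := by
  have h := (orthonormal_toLp_monoidHom μ hinj hχ).tsum_inner_products_le (hf.toLp f)
  have hterm : ∀ i, ‖inner ℂ ((memLp_monoidHom μ (hχ i)).toLp _) (hf.toLp f)‖ ^ 2 = ‖∫ x, conj (χ i x : ℂ) * f x ∂μ‖ ^ 2 :=
    fun i => by rw [inner_toLp_monoidHom_toLp μ (hχ i) hf]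
  calc ∑' i, ‖∫ x, conj (χ i x : ℂ) * f x ∂μ‖ ^ 2 = ∑' i, ‖inner ℂ ((memLp_monoidHom μ (hχ i)).toLp _) (hf.toLp f)‖ ^ 2 :=
        tsum_congr fun i => (hterm i).symm
    _ ≤ ‖hf.toLp f‖ ^ 2 := h
    _ = ∫ x, ‖f x‖ ^ 2 ∂μ := Literature.NumberTheory.Automorphic.norm_toLp_sq μ hf

/-- **RIEMANN–LEBESGUE (compact ∕ invariant-probability form).**  For `f ∈ L²(G, μ)`, `μ` a left-invariant probability measure, and an injective
family of continuous unitary characters `χ_i : G →* Circle`, the Fourier coefficients `∫ conj(χ_i) f dμ` TEND TO `0` along the cofinite filter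
(Bessel ⇒ square summable ⇒ decay).  For `G = [U(1)]` (compact), `f` the continuous density of `det_*(f·η)`, this is `f̂(χ) → 0`, the
eigenvalue input of ★ rung 1 `K2E1DiagonalCharacterOperatorCompact`. [folklore] [cite: MoeglinWaldspurger1995, I.2.18] -/
theorem tendsto_integral_conj_monoidHom_mul_cofinite {ι : Type*} {χ : ι → G →* Circle} (hinj : Function.Injective χ)
    (hχ : ∀ i, Continuous fun x => (χ i x : ℂ)) {f : G → ℂ} (hf : MemLp f 2 μ) :
    Tendsto (fun i => ∫ x, conj (χ i x : ℂ) * f x ∂μ) cofinite (𝓝 0) :=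
  tendsto_cofinite_zero_of_summable_norm_sq (summable_norm_sq_integral_conj_monoidHom_mul μ hinj hχ hf)

/-- **Riemann–Lebesgue, un-conjugated form**: `∫ χ_i f dμ → 0` cofinitely (conjugate the conjugated form applied to `conj ∘ f ∈ L²`).
[folklore] -/
theorem tendsto_integral_monoidHom_mul_cofinite {ι : Type*} {χ : ι → G →* Circle} (hinj : Function.Injective χ)
    (hχ : ∀ i, Continuous fun x => (χ i x : ℂ)) {f : G → ℂ} (hf : MemLp f 2 μ) :
    Tendsto (fun i => ∫ x, (χ i x : ℂ) * f x ∂μ) cofinite (𝓝 0) := by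
  -- `conj ∘ f ∈ L²`, and `∫ χ f = conj (∫ conj χ · conj f)`
  have hfc : MemLp (fun x => conj (f x)) 2 μ :=
    MemLp.of_le hf (Complex.continuous_conj.comp_aestronglyMeasurable hf.1)
      (Filter.Eventually.of_forall fun x => (RCLike.norm_conj (f x)).le)
  have h := tendsto_integral_conj_monoidHom_mul_cofinite μ hinj hχ hfc
  have h2 : Tendsto (fun i => conj (∫ x, conj (χ i x : ℂ) * conj (f x) ∂μ)) cofinite (𝓝 0) := by
    have h3 := (Complex.continuous_conj.tendsto 0).comp h
    rwa [map_zero] at h3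
  refine h2.congr fun i => ?_
  rw [← integral_conj]
  refine integral_congr_ae (Filter.Eventually.of_forall fun x => ?_)
  simp only [map_mul, Complex.conj_conj]

/-- **Riemann–Lebesgue for a continuous function on a COMPACT group** (continuous `f` is bounded, hence in `L²` of the probability measure).
[folklore] -/
theorem tendsto_integral_conj_monoidHom_mul_cofinite_of_continuous [CompactSpace G] {ι : Type*} {χ : ι → G →* Circle}
    (hinj : Function.Injective χ) (hχ : ∀ i, Continuous fun x => (χ i x : ℂ)) {f : G → ℂ} (hf : Continuous f) :
    Tendsto (fun i => ∫ x, conj (χ i x : ℂ) * f x ∂μ) cofinite (𝓝 0) := by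
  obtain ⟨C, hC⟩ := isCompact_univ.exists_bound_of_continuousOn hf.continuousOn
  exact tendsto_integral_conj_monoidHom_mul_cofinite μ hinj hχ
    (MemLp.of_bound hf.aestronglyMeasurable C (Filter.Eventually.of_forall fun x => hC x (Set.mem_univ x)))

/-- The ε-FORM consumed by ★ rung 1 (`K2E1DiagonalCharacterOperatorCompact.tendsto_cofinite_zero_iff`): for every `ε > 0` only FINITELY MANY
characters of the family have a Fourier coefficient of modulus `≥ ε`. [folklore] -/
theorem finite_setOf_le_norm_integral_conj_monoidHom_mul {ι : Type*} {χ : ι → G →* Circle} (hinj : Function.Injective χ)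
    (hχ : ∀ i, Continuous fun x => (χ i x : ℂ)) {f : G → ℂ} (hf : MemLp f 2 μ) {ε : ℝ} (hε : 0 < ε) :
    {i | ε ≤ ‖∫ x, conj (χ i x : ℂ) * f x ∂μ‖}.Finite := by
  have h := (Metric.tendsto_nhds.1 (tendsto_integral_conj_monoidHom_mul_cofinite μ hinj hχ hf)) ε hε
  simp only [dist_zero_right, eventually_cofinite, not_lt] at h
  exact h

end L2

end Characters

/-! ## §3 The additive corollary (characters `AddChar C Circle`, e.g. of `𝔸_K ⧸ K`), over the ★ additive Bessel -/

section Additive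

variable {C : Type*} [AddCommGroup C] [MeasurableSpace C] (μ : Measure C) [TopologicalSpace C] [OpensMeasurableSpace C]
  [IsProbabilityMeasure μ] [MeasurableAdd C] [μ.IsAddLeftInvariant]

/-- **Riemann–Lebesgue for additive characters**: for `f ∈ L²(C, μ)` (`μ` an invariant probability measure on the additive group `C`) and an
injective family of continuous `χ_i : AddChar C Circle`, `∫ conj(χ_i) f dμ → 0` cofinitely (★ `summable_norm_sq_integral_conj_addChar_mul`).
[folklore] -/
theorem tendsto_integral_conj_addChar_mul_cofinite {ι : Type*} {χ : ι → AddChar C Circle} (hinj : Function.Injective χ)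
    (hχ : ∀ i, Continuous fun x => (χ i x : ℂ)) {f : C → ℂ} (hf : MemLp f 2 μ) :
    Tendsto (fun i => ∫ x, conj (χ i x : ℂ) * f x ∂μ) cofinite (𝓝 0) :=
  tendsto_cofinite_zero_of_summable_norm_sq (Literature.NumberTheory.Automorphic.summable_norm_sq_integral_conj_addChar_mul μ hinj hχ hf)

end Additive

end Summit.HodgeConjecture.HodgeConjecture.Cruxes.H413.K2E1CompactAbelianRiemannLebesgue

end
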